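import Literature.Geometry.Riemannian.CuspedHyperbolic
import HarnessLib

/-!
# Topology of torus cusps and of Dehn fillings

Support file (everything proved; no named fact, no `sorry`) for the Gromov–Thurston `2π` theorem
`Literature.Geometry.Riemannian.gromovThurston_twoPi_four` (`CuspedHyperbolic.lean`): the
point-set topology of the cusp neighbourhoods `C ({t ≥ a})` of a `TorusCusp`
(`CuspedHyperbolic.lean`; Benedetti–Petronio 1992, Prop. D.3.12) and of a Dehn filling
`IsDehnFilling S A P` (Anderson 2006, §2.1, (2.2)–(2.3)), needed to enlarge the cusps slightly
(the smoothing of the `2π` theorem starts at a negative height `t_h < 0` when a slope has length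
exactly `2π`) and to see that the modified region is closed.

* `TorusCusp.box`, `exists_add_mem_box`, `image_eq_image_box_prod` — a compact fundamental
  domain of the cusp lattice and the reduction of images `C '' {t ∈ T}` to it (periodicity);
  `isCompact_image_Icc` — `C '' {a ≤ t ≤ b}` is compact for `a > -ε`;
* `TorusCusp.exists_collar_subset` — an open set containing the cusp torus `C ({t = 0})`
  contains a collar `C ({|t| < e})` (generalised tube lemma);
* `TorusCuspSystem.exists_level` — if the closed cusp neighbourhoods are closed sets, there is
  a level `t_h < 0` above `-ε_i` for all `i` such that the ENLARGED open cusps `C_i ({t > t_h})`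
  are still pairwise disjoint;
* for a Dehn filling (`jA`, `jB` as in `IsDehnFilling`): the punctured filling pieces are the
  open cusps (`apply_cusp_mem_range`, `norm_eq_exp_neg`), the core tori miss `range jA`
  (`core_not_mem_range`), points off `range jA` are core points (`exists_core_of_not_mem_range`),
  and consequently `C_i '' {t ≥ a}` is closed in `X` (`isClosed_image_Ici`) and in particular so
  is every `closedNbhd` (`isClosed_closedNbhd`).

## References

* M. T. Anderson, *Dehn filling and Einstein metrics in higher dimensions*, J. Differential Geom.
  73 (2006) 219–261, §2.1. [Anderson2006]
* R. Benedetti, C. Petronio, *Lectures on Hyperbolic Geometry* (1992), Prop. D.3.12.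
  [BenedettiPetronio1992]
-/

noncomputable section

open Set Function Filter TopologicalSpace Bundle
open scoped Manifold ContDiff Topology

namespace Literature.Geometry.Riemannian

open Literature.Geometry.Lorentzian (PseudoRiemannianMetric)
open Literature.Topology.FourManifolds (circlePoint)

/-- Local notation: `𝔼 n` is the model Euclidean space `EuclideanSpace ℝ (Fin n)`. -/
local notation "𝔼 " n:arg => EuclideanSpace ℝ (Fin n)

/-- Local notation: `𝕊 n` is the unit sphere in `EuclideanSpace ℝ (Fin (n + 1))`. -/
local notation "𝕊 " n:arg => (Metric.sphere (0 : EuclideanSpace ℝ (Fin (n + 1))) 1)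

variable {E : Type*} [NormedAddCommGroup E] [NormedSpace ℝ E] {H : Type*} [TopologicalSpace H]
  {I : ModelWithCorners ℝ E H} {M : Type*} [TopologicalSpace M] [ChartedSpace H M]
  [IsManifold I ∞ M] {n : ℕ∞ω} {g : PseudoRiemannianMetric I n E (TangentSpace I : M → Type _)}
  {m : ℕ}

namespace TorusCusp

/-! ### A compact fundamental domain -/

/-- The map `s ↦ ∑ sᵢ vᵢ` from coordinates to the lattice plane. [folklore] -/
def boxMap (C : TorusCusp g m) (s : Fin m → ℝ) : 𝔼 m := ∑ i, s i • C.basis i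

/-- `boxMap` is continuous. [folklore] -/
theorem continuous_boxMap (C : TorusCusp g m) : Continuous C.boxMap :=
  continuous_finsetSum _ fun i _ ↦ (continuous_apply i).smul continuous_const

/-- The **fundamental box** `{∑ sᵢ vᵢ | s ∈ [0,1]ᵐ}` of the cusp lattice. [folklore] -/
def box (C : TorusCusp g m) : Set (𝔼 m) := C.boxMap '' Set.pi univ fun _ ↦ Icc (0 : ℝ) 1

/-- The fundamental box is compact. [folklore] -/
theorem isCompact_box (C : TorusCusp g m) : IsCompact C.box :=
  (isCompact_univ_pi fun _ ↦ isCompact_Icc).image C.continuous_boxMap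

/-- **Every point is a lattice translate of a point of the box** (integer and fractional parts
of the coordinates). [folklore] -/
theorem exists_add_mem_box (C : TorusCusp g m) (x : 𝔼 m) : ∃ ℓ ∈ C.lattice, x + ℓ ∈ C.box := by
  set c : Fin m → ℝ := C.basis.equivFun x with hc
  refine ⟨C.latticeVector fun i ↦ -⌊c i⌋, C.latticeVector_mem_lattice _, ?_⟩
  refine ⟨fun i ↦ Int.fract (c i), fun i _ ↦ ⟨Int.fract_nonneg _, (Int.fract_lt_one _).le⟩, ?_⟩
  have hx : x = ∑ i, c i • C.basis i := (C.basis.sum_equivFun x).symm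
  simp only [boxMap, latticeVector, Int.fract, Int.cast_neg, sub_smul, neg_smul,
    Finset.sum_sub_distrib, Finset.sum_neg_distrib]
  rw [hx]
  abel

/-- **Reduction to the box**: for a set of heights `T` inside the region, the image
`C '' {p | p.2 ∈ T}` is the image of `box × T` (lattice periodicity). [folklore] -/
theorem image_eq_image_box_prod (C : TorusCusp g m) {T : Set ℝ} (hT : ∀ t ∈ T, -C.eps < t) :
    C '' {p | p.2 ∈ T} = C '' (C.box ×ˢ T) := by
  refine Subset.antisymm ?_ (image_mono fun p hp ↦ hp.2)
  rintro _ ⟨⟨x, t⟩, ht, rfl⟩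
  obtain ⟨ℓ, hℓ, hb⟩ := C.exists_add_mem_box x
  refine ⟨(x + ℓ, t), ⟨hb, ht⟩, ?_⟩
  exact C.apply_add_of_mem_lattice hℓ x (hT t ht)

/-- **`C '' {a ≤ t ≤ b}` is compact** for `a > -ε` (continuous image of `box × [a, b]`).
[folklore] -/
theorem isCompact_image_Icc (C : TorusCusp g m) {a b : ℝ} (ha : -C.eps < a) :
    IsCompact (C '' {p | a ≤ p.2 ∧ p.2 ≤ b}) := by
  have h := C.image_eq_image_box_prod (T := Icc a b) fun t ht ↦ lt_of_lt_of_le ha ht.1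
  change C '' {p | p.2 ∈ Icc a b} = _ at h
  rw [show {p : (𝔼 m) × ℝ | a ≤ p.2 ∧ p.2 ≤ b} = {p | p.2 ∈ Icc a b} from rfl, h]
  refine (C.isCompact_box.prod isCompact_Icc).image_of_continuousOn
    (C.contMDiffOn.continuousOn.mono ?_)
  rintro ⟨x, t⟩ ⟨-, ht⟩
  exact lt_of_lt_of_le ha ht.1

/-- The cusp torus is the image of `box × {0}`. [folklore] -/
theorem cuspTorus_eq_image_box (C : TorusCusp g m) : C.cuspTorus = C '' (C.box ×ˢ {(0 : ℝ)}) := by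
  rw [cuspTorus]
  exact C.image_eq_image_box_prod (T := {(0 : ℝ)}) fun t ht ↦ by
    rw [mem_singleton_iff.1 ht]; simpa using C.eps_pos

/-- **Collars**: an open set containing the cusp torus `C ({t = 0})` contains a whole collar
`C ({-e < t < e})`, `0 < e < ε` (generalised tube lemma over the compact box). [folklore] -/
theorem exists_collar_subset (C : TorusCusp g m) {U : Set M} (hU : IsOpen U)
    (h0 : C.cuspTorus ⊆ U) :
    ∃ e : ℝ, 0 < e ∧ e < C.eps ∧ C '' {p | -e < p.2 ∧ p.2 < e} ⊆ U := by
  set R : Set ((𝔼 m) × ℝ) := {p | -C.eps < p.2} with hR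
  have hRo : IsOpen R := C.isOpen_region
  set O : Set ((𝔼 m) × ℝ) := R ∩ C ⁻¹' U with hO
  have hOo : IsOpen O := C.contMDiffOn.continuousOn.isOpen_inter_preimage hRo hU
  have hsub : C.box ×ˢ {(0 : ℝ)} ⊆ O := by
    rintro ⟨x, t⟩ ⟨hx, ht⟩
    rw [mem_singleton_iff] at ht
    subst ht
    refine ⟨by simpa [hR] using C.eps_pos, ?_⟩
    apply h0
    rw [cuspTorus_eq_image_box]
    exact ⟨(x, 0), ⟨hx, rfl⟩, rfl⟩
  obtain ⟨u, v, hu, hv, hbu, h0v, huv⟩ :=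
    generalized_tube_lemma C.isCompact_box isCompact_singleton hOo hsub
  have hv0 : v ∈ 𝓝 (0 : ℝ) := hv.mem_nhds (h0v rfl)
  obtain ⟨e, he, hev⟩ := Metric.mem_nhds_iff.1 hv0
  refine ⟨min e C.eps / 2, div_pos (lt_min he C.eps_pos) two_pos,
    by linarith [min_le_right e C.eps, C.eps_pos, lt_min he C.eps_pos], ?_⟩
  have hlt : min e C.eps / 2 < C.eps := by
    linarith [min_le_right e C.eps, lt_min he C.eps_pos]
  rw [show {p : (𝔼 m) × ℝ | -(min e C.eps / 2) < p.2 ∧ p.2 < min e C.eps / 2} =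
      {p | p.2 ∈ Ioo (-(min e C.eps / 2)) (min e C.eps / 2)} from rfl,
    C.image_eq_image_box_prod (T := Ioo _ _) fun t ht ↦ by linarith [ht.1]]
  rintro _ ⟨⟨x, t⟩, ⟨hx, ht⟩, rfl⟩
  have htv : t ∈ v := hev (by
    rw [Metric.mem_ball, Real.dist_0_eq_abs, abs_lt]
    constructor <;> linarith [ht.1, ht.2, min_le_left e C.eps])
  exact (huv ⟨hbu hx, htv⟩).2

/-- Points of a collar below height `0` with `-e ≤ t ≤ 0`. [folklore] -/
theorem image_mono_heights (C : TorusCusp g m) {T T' : Set ℝ} (h : T ⊆ T') :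
    C '' {p | p.2 ∈ T} ⊆ C '' {p | p.2 ∈ T'} :=
  image_mono fun _ hp ↦ h hp

end TorusCusp

/-! ### A level below `0` at which the enlarged cusps are still disjoint -/

namespace TorusCuspSystem

variable {k : ℕ}

/-- **Enlarging the cusps.** If the closed cusp neighbourhoods of a cusp system are closed sets
of `M` (true for the cusps of a cusped hyperbolic manifold with a Dehn filling,
`isClosed_closedNbhd`), then there is a level `t_h < 0`, above `-ε_i` for every cusp, such that
the enlarged open cusps `C_i ({t > t_h})` are still pairwise disjoint. (Twice the collar lemma:
first separate each cusp torus from the other closed cusps, then from the other compact collars.)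
[folklore] -/
theorem exists_level [T2Space M] (S : TorusCuspSystem g k m)
    (hclosed : ∀ j, IsClosed (S.cusp j).closedNbhd) :
    ∃ th : ℝ, th < 0 ∧ (∀ i, -(S.cusp i).eps < th) ∧
      Pairwise fun i j ↦ Disjoint ((S.cusp i) '' {p | th < p.2}) ((S.cusp j) '' {p | th < p.2}) := by
  -- Step 1: collars missing the other closed cusps
  have step1 : ∀ i, ∃ e : ℝ, 0 < e ∧ e < (S.cusp i).eps ∧
      ∀ j, j ≠ i → Disjoint ((S.cusp i) '' {p | -e < p.2 ∧ p.2 < e}) (S.cusp j).closedNbhd := by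
    intro i
    set U : Set M := (⋃ j ∈ {j | j ≠ i}, (S.cusp j).closedNbhd)ᶜ with hU
    have hUo : IsOpen U := by
      rw [hU, isOpen_compl_iff]
      exact (Set.toFinite _).isClosed_biUnion fun j _ ↦ hclosed j
    have hsub : (S.cusp i).cuspTorus ⊆ U := by
      intro y hy
      rw [hU, mem_compl_iff, mem_iUnion₂]
      rintro ⟨j, hj, hyj⟩
      exact Set.disjoint_left.1 (S.disjoint (Ne.symm hj))
        ((S.cusp i).cuspTorus_subset_closedNbhd hy) hyj
    obtain ⟨e, he, heε, hcol⟩ := (S.cusp i).exists_collar_subset hUo hsub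
    refine ⟨e, he, heε, fun j hj ↦ Set.disjoint_left.2 fun y hy hyj ↦ ?_⟩
    have := hcol hy
    rw [hU, mem_compl_iff, mem_iUnion₂] at this
    exact this ⟨j, hj, hyj⟩
  choose e he heε hdisj using step1
  -- a common `e₁`
  obtain ⟨e₁, he₁, he₁le⟩ : ∃ e₁ : ℝ, 0 < e₁ ∧ ∀ i, e₁ ≤ e i := by
    by_cases hk : k = 0
    · subst hk
      exact ⟨1, one_pos, fun i ↦ i.elim0⟩
    · haveI : Nonempty (Fin k) := ⟨⟨0, Nat.pos_of_ne_zero hk⟩⟩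
      refine ⟨Finset.univ.inf' Finset.univ_nonempty e, ?_, fun i ↦ Finset.inf'_le _ (Finset.mem_univ i)⟩
      obtain ⟨i, -, hi⟩ := Finset.exists_mem_eq_inf' Finset.univ_nonempty e
      rw [hi]; exact he i
  -- Step 2: collars missing the other compact collars `C_j '' {-e₁/2 ≤ t ≤ 0}`
  have step2 : ∀ i, ∃ e' : ℝ, 0 < e' ∧ e' < (S.cusp i).eps ∧
      ∀ j, j ≠ i → Disjoint ((S.cusp i) '' {p | -e' < p.2 ∧ p.2 < e'})
        ((S.cusp j) '' {p | -(e₁ / 2) ≤ p.2 ∧ p.2 ≤ 0}) := by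
    intro i
    set U : Set M := (⋃ j ∈ {j | j ≠ i}, (S.cusp j) '' {p | -(e₁ / 2) ≤ p.2 ∧ p.2 ≤ 0})ᶜ with hU
    have hUo : IsOpen U := by
      rw [hU, isOpen_compl_iff]
      refine (Set.toFinite _).isClosed_biUnion fun j _ ↦ IsCompact.isClosed ?_
      exact (S.cusp j).isCompact_image_Icc (by linarith [he₁le j, heε j])
    have hsub : (S.cusp i).cuspTorus ⊆ U := by
      intro y hy
      rw [hU, mem_compl_iff, mem_iUnion₂]
      rintro ⟨j, hj, hyj⟩
      -- `y ∈ closedNbhd i` and the collar of `j` misses `closedNbhd i`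
      have h1 : y ∈ (S.cusp j) '' {p | -e j < p.2 ∧ p.2 < e j} := by
        obtain ⟨p, hp, rfl⟩ := hyj
        exact ⟨p, ⟨by linarith [hp.1, he₁le j], by linarith [hp.2, he j]⟩, rfl⟩
      exact Set.disjoint_left.1 (hdisj j i (Ne.symm hj)) h1
        ((S.cusp i).cuspTorus_subset_closedNbhd hy)
    obtain ⟨e', he', he'ε, hcol⟩ := (S.cusp i).exists_collar_subset hUo hsub
    refine ⟨e', he', he'ε, fun j hj ↦ Set.disjoint_left.2 fun y hy hyj ↦ ?_⟩
    have := hcol hy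
    rw [hU, mem_compl_iff, mem_iUnion₂] at this
    exact this ⟨j, hj, hyj⟩
  choose e' he' he'ε hdisj' using step2
  obtain ⟨e₂, he₂, he₂le, he₂e₁⟩ : ∃ e₂ : ℝ, 0 < e₂ ∧ (∀ i, e₂ ≤ e' i) ∧ e₂ ≤ e₁ / 2 := by
    by_cases hk : k = 0
    · subst hk
      exact ⟨e₁ / 2, by positivity, fun i ↦ i.elim0, le_rfl⟩
    · haveI : Nonempty (Fin k) := ⟨⟨0, Nat.pos_of_ne_zero hk⟩⟩
      refine ⟨min (Finset.univ.inf' Finset.univ_nonempty e') (e₁ / 2), ?_,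
        fun i ↦ (min_le_left _ _).trans (Finset.inf'_le _ (Finset.mem_univ i)), min_le_right _ _⟩
      refine lt_min ?_ (by positivity)
      obtain ⟨i, -, hi⟩ := Finset.exists_mem_eq_inf' Finset.univ_nonempty e'
      rw [hi]; exact he' i
  have he₂e : ∀ i, e₂ ≤ e i := fun i ↦ by linarith [he₁le i]
  refine ⟨-e₂, by linarith, fun i ↦ by linarith [he'ε i, he₂le i], ?_⟩
  intro i j hij
  refine Set.disjoint_left.2 ?_
  rintro y ⟨p, (hp : -e₂ < p.2), rfl⟩ ⟨p', (hp' : -e₂ < p'.2), hy⟩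
  -- case analysis on the signs of the heights
  rcases le_or_gt p.2 0 with hp0 | hp0 <;> rcases le_or_gt p'.2 0 with hp0' | hp0'
  · -- both in the collars: `C_i p` in collar of `i`, `C_j p'` in compact collar of `j`
    refine Set.disjoint_left.1 (hdisj' i j hij.symm) ⟨p, ⟨by linarith [he₂le i], by
      linarith [he' i]⟩, rfl⟩ ⟨p', ⟨by linarith, hp0'⟩, hy⟩
  · -- `C_j p' ∈ closedNbhd j`, `C_i p` in the collar of `i`
    refine Set.disjoint_left.1 (hdisj i j hij.symm) ⟨p, ⟨by linarith [he₂e i], by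
      linarith [he i]⟩, rfl⟩ ⟨p', le_of_lt hp0', hy⟩
  · refine Set.disjoint_left.1 (hdisj j i hij) ⟨p', ⟨by linarith [he₂e j], by
      linarith [he j]⟩, hy⟩ ⟨p, le_of_lt hp0, rfl⟩
  · exact Set.disjoint_left.1 (S.disjoint hij) ((S.cusp i).openNbhd_subset_closedNbhd ⟨p, hp0, rfl⟩)
      ((S.cusp j).openNbhd_subset_closedNbhd ⟨p', hp0', hy⟩)

end TorusCuspSystem

/-! ### Dehn fillings: cusps versus filling pieces -/

section DehnFilling

open Matrix

variable {X : Type*} [TopologicalSpace X] [ChartedSpace (𝔼 4) X] [IsManifold (𝓡 4) ∞ X]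
  {g : PseudoRiemannianMetric (𝓡 4) ∞ (𝔼 4) (TangentSpace (𝓡 4) : X → Type _)}
  {k : ℕ} (S : TorusCuspSystem g k 3) (A : Fin k → Matrix (Fin 3) (Fin 3) ℤ)
  {P : Type*} [TopologicalSpace P]
  (jA : X → P) (jB : Fin k → fillingPiece → P)

/-- The point `(a, b)` of the plane `𝔼 2`. [folklore] -/
def mk2 (a b : ℝ) : 𝔼 2 := WithLp.toLp 2 ![a, b]

/-- Coordinates of `mk2`. [folklore] -/
@[simp] theorem mk2_apply_zero (a b : ℝ) : mk2 a b 0 = a := rfl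

/-- Coordinates of `mk2`. [folklore] -/
@[simp] theorem mk2_apply_one (a b : ℝ) : mk2 a b 1 = b := rfl

/-- `‖(a, b)‖² = a² + b²`. [folklore] -/
theorem norm_mk2_sq (a b : ℝ) : ‖mk2 a b‖ ^ 2 = a ^ 2 + b ^ 2 := by
  rw [EuclideanSpace.norm_sq_eq, Fin.sum_univ_two]
  simp [mk2]

/-- A point of `𝕊 1 ⊆ 𝔼 2` has norm `1`. [folklore] -/
theorem norm_coe_circlePoint (θ : ℝ) : ‖((circlePoint θ : 𝕊 1) : 𝔼 2)‖ = 1 :=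
  norm_eq_of_mem_sphere _

/-- `‖r • circlePoint θ‖ = r` for `r ≥ 0`. [folklore] -/
theorem norm_smul_circlePoint {r : ℝ} (hr : 0 ≤ r) (θ : ℝ) :
    ‖r • ((circlePoint θ : 𝕊 1) : 𝔼 2)‖ = r := by
  rw [norm_smul, norm_coe_circlePoint, mul_one, Real.norm_of_nonneg hr]

/-- **Polar form in the plane**: a non-zero `w ∈ 𝔼 2` is `‖w‖ (cos θ, sin θ)`. [folklore] -/
theorem exists_eq_norm_smul_circlePoint (w : 𝔼 2) (hw : w ≠ 0) :
    ∃ θ : ℝ, w = ‖w‖ • ((circlePoint θ : 𝕊 1) : 𝔼 2) := by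
  set z : ℂ := ⟨w 0, w 1⟩ with hz
  have hre : z.re = w 0 := rfl
  have him : z.im = w 1 := rfl
  have hz0 : z ≠ 0 := by
    intro h0
    apply hw
    rw [Complex.ext_iff] at h0
    ext i
    fin_cases i
    · exact h0.1
    · exact h0.2
  have hr : ‖z‖ = ‖w‖ := by
    rw [Complex.norm_eq_sqrt_sq_add_sq, EuclideanSpace.norm_eq, Fin.sum_univ_two, hre, him]
    simp [sq_abs]
  have hn : ‖w‖ ≠ 0 := norm_ne_zero_iff.2 hw
  have h0 : w 0 = ‖w‖ * Real.cos (Complex.arg z) := by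
    rw [Complex.cos_arg hz0, hr, hre]
    field_simp
  have h1 : w 1 = ‖w‖ * Real.sin (Complex.arg z) := by
    rw [Complex.sin_arg, hr, him]
    field_simp
  refine ⟨Complex.arg z, ?_⟩
  ext i
  fin_cases i
  · simpa using h0
  · simpa using h1

/-- The point `((e^{iθ₁}, e^{iθ₂}), r e^{iθ₃})` of the filling piece, `0 ≤ r < 1`. [folklore] -/
def piecePoint (θ₁ θ₂ θ₃ r : ℝ) (hr0 : 0 ≤ r) (hr1 : r < 1) : fillingPiece :=
  ⟨((circlePoint θ₁, circlePoint θ₂), r • ((circlePoint θ₃ : 𝕊 1) : 𝔼 2)), by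
    rw [mem_fillingPiece_iff]
    change ‖r • ((circlePoint θ₃ : 𝕊 1) : 𝔼 2)‖ < 1
    rwa [norm_smul_circlePoint hr0]⟩

/-- The value of `piecePoint`. [folklore] -/
@[simp] theorem coe_piecePoint (θ₁ θ₂ θ₃ r : ℝ) (hr0 : 0 ≤ r) (hr1 : r < 1) :
    ((piecePoint θ₁ θ₂ θ₃ r hr0 hr1 : fillingPiece) : ((𝕊 1) × (𝕊 1)) × (𝔼 2)) =
      ((circlePoint θ₁, circlePoint θ₂), r • ((circlePoint θ₃ : 𝕊 1) : 𝔼 2)) := rfl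

/-- The cusp point `x(θ) = θ₁ a₀/2π + θ₂ a₁/2π + θ₃ a₂/2π` of the filling relation. [folklore] -/
def cuspPt (C : TorusCusp g 3) (B : Matrix (Fin 3) (Fin 3) ℤ) (θ₁ θ₂ θ₃ : ℝ) : 𝔼 3 :=
  (θ₁ / (2 * Real.pi)) • C.latticeVector (fun l ↦ B l 0) +
    (θ₂ / (2 * Real.pi)) • C.latticeVector (fun l ↦ B l 1) +
    (θ₃ / (2 * Real.pi)) • C.latticeVector (fun l ↦ B l 2)

variable {S A jA jB}
variable (hrel : ∀ (i : Fin k) (a : X) (b : fillingPiece),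
  jA a = jB i b ↔ (S.cusp i).fillingRel (A i) a (b : ((𝕊 1) × (𝕊 1)) × (𝔼 2)))

omit [TopologicalSpace P] in
include hrel in
/-- **The punctured filling piece is the open cusp**: for `0 < r < 1`,
`jA (C (x(θ), -log r)) = jB ((e^{iθ₁}, e^{iθ₂}), r e^{iθ₃})` (the `⇐` direction of the
filling relation). [cite: Anderson2006, §2.1, (2.2)] -/
theorem apply_cusp_eq (i : Fin k) (θ₁ θ₂ θ₃ r : ℝ) (hr0 : 0 < r) (hr1 : r < 1) :
    jA ((S.cusp i) (cuspPt (S.cusp i) (A i) θ₁ θ₂ θ₃, -Real.log r)) =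
      jB i (piecePoint θ₁ θ₂ θ₃ r hr0.le hr1) :=
  (hrel i _ _).2 ⟨θ₁, θ₂, θ₃, r, hr0, hr1, rfl, rfl⟩

omit [TopologicalSpace P] in
include hrel in
/-- **The core tori miss `range jA`**: `jB ((u, v), 0) ≠ jA a` (the filling relation forces a
positive radius). [cite: Anderson2006, §2.1, (2.3)] -/
theorem core_not_mem_range (i : Fin k) (u v : 𝕊 1)
    (h : (((u, v), (0 : 𝔼 2)) : ((𝕊 1) × (𝕊 1)) × (𝔼 2)) ∈ fillingPiece) :
    jB i ⟨((u, v), 0), h⟩ ∉ range jA := by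
  rintro ⟨a, ha⟩
  obtain ⟨θ₁, θ₂, θ₃, r, hr0, -, hq, -⟩ := (hrel i a _).1 ha
  have h2 := congrArg (fun q : ((𝕊 1) × (𝕊 1)) × (𝔼 2) ↦ ‖q.2‖) hq
  simp only [norm_zero] at h2
  rw [norm_smul_circlePoint hr0.le] at h2
  exact hr0.ne' h2.symm

omit [TopologicalSpace P] in
include hrel in
/-- A point of a filling piece with non-zero disc coordinate lies in `range jA`. [folklore] -/
theorem mem_range_of_ne_zero (i : Fin k) (b : fillingPiece)
    (hb : (b : ((𝕊 1) × (𝕊 1)) × (𝔼 2)).2 ≠ 0) : jB i b ∈ range jA := by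
  obtain ⟨⟨⟨u, v⟩, w⟩, hmem⟩ := b
  change w ≠ 0 at hb
  obtain ⟨θ₁, rfl⟩ := Literature.Topology.FourManifolds.circlePoint_surjective u
  obtain ⟨θ₂, rfl⟩ := Literature.Topology.FourManifolds.circlePoint_surjective v
  obtain ⟨θ₃, hw⟩ := exists_eq_norm_smul_circlePoint w hb
  have hr0 : 0 < ‖w‖ := norm_pos_iff.2 hb
  have hr1 : ‖w‖ < 1 := by simpa using hmem
  refine ⟨(S.cusp i) (cuspPt (S.cusp i) (A i) θ₁ θ₂ θ₃, -Real.log ‖w‖), ?_⟩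
  rw [apply_cusp_eq hrel i θ₁ θ₂ θ₃ ‖w‖ hr0 hr1]
  congr 1
  apply Subtype.ext
  simp only [coe_piecePoint]
  rw [← hw]

omit [TopologicalSpace P] in
include hrel in
/-- **Points off `range jA` are core points** `jB ((u, v), 0)`. [folklore] -/
theorem exists_core_of_not_mem_range (hcover : range jA ∪ (⋃ i, range (jB i)) = univ) {p : P}
    (hp : p ∉ range jA) :
    ∃ (i : Fin k) (u v : 𝕊 1) (h : (((u, v), (0 : 𝔼 2)) : ((𝕊 1) × (𝕊 1)) × (𝔼 2)) ∈ fillingPiece),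
      p = jB i ⟨((u, v), 0), h⟩ := by
  have : p ∈ range jA ∪ ⋃ i, range (jB i) := by rw [hcover]; trivial
  rcases this with h | h
  · exact absurd h hp
  · obtain ⟨i, b, rfl⟩ : ∃ i b, jB i b = p := by simpa [mem_iUnion] using h
    by_cases hb : (b : ((𝕊 1) × (𝕊 1)) × (𝔼 2)).2 = 0
    · obtain ⟨⟨⟨u, v⟩, w⟩, hmem⟩ := b
      change w = 0 at hb
      subst hb
      exact ⟨i, u, v, hmem, rfl⟩
    · exact absurd (mem_range_of_ne_zero hrel i b hb) hp

/-- **Angle coordinates exist**: every `x ∈ 𝔼 3` is `x(θ)` for some `θ`, because the columns of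
`A ∈ GL(3, ℤ)` form a basis of the cusp lattice plane. [folklore] -/
theorem exists_cuspPt_eq (C : TorusCusp g 3) (B : Matrix (Fin 3) (Fin 3) ℤ)
    (hB : B.det = 1 ∨ B.det = -1) (x : 𝔼 3) :
    ∃ θ₁ θ₂ θ₃ : ℝ, cuspPt C B θ₁ θ₂ θ₃ = x := by
  set B' : Matrix (Fin 3) (Fin 3) ℝ := (Int.castRingHom ℝ).mapMatrix B with hB'
  have hdet : IsUnit B'.det := by
    rw [hB', ← RingHom.map_det]
    rcases hB with h | h <;> simp [h]
  set d : Fin 3 → ℝ := C.basis.equivFun x with hd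
  set c : Fin 3 → ℝ := B'⁻¹ *ᵥ d with hc
  have hBc : B' *ᵥ c = d := by
    rw [hc, mulVec_mulVec, mul_nonsing_inv _ hdet, one_mulVec]
  -- `∑_j c_j a_j = ∑_l (B' c)_l v_l = x`
  have hsum : ∑ j, c j • C.latticeVector (fun l ↦ B l j) = x := by
    have h1 : ∀ j, c j • C.latticeVector (fun l ↦ B l j) = ∑ l, (c j * (B l j : ℝ)) • C.basis l := by
      intro j
      simp only [TorusCusp.latticeVector, Finset.smul_sum, smul_smul]
    simp_rw [h1]
    rw [Finset.sum_comm]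
    have h2 : ∀ l, ∑ j, (c j * (B l j : ℝ)) • C.basis l = (B' *ᵥ c) l • C.basis l := by
      intro l
      rw [← Finset.sum_smul]
      congr 1
      simp [hB', Matrix.mulVec, dotProduct, mul_comm]
    simp_rw [h2, hBc, hd]
    exact C.basis.sum_equivFun x
  refine ⟨2 * Real.pi * c 0, 2 * Real.pi * c 1, 2 * Real.pi * c 2, ?_⟩
  rw [← hsum, Fin.sum_univ_three, cuspPt]
  have hπ : (2 * Real.pi) ≠ 0 := by positivity
  simp only [mul_div_cancel_left₀ _ hπ]

/-- The part `{‖w‖ ≤ ρ}`, `ρ < 1`, of the filling piece is compact (it is the continuous image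
of the compact `T² × B̄(0, ρ)`). [folklore] -/
theorem isCompact_fillingPiece_le {ρ : ℝ} (hρ : ρ < 1) :
    IsCompact {q : fillingPiece | ‖(q : ((𝕊 1) × (𝕊 1)) × (𝔼 2)).2‖ ≤ ρ} := by
  set φ : ((𝕊 1) × (𝕊 1)) × Metric.closedBall (0 : 𝔼 2) ρ → fillingPiece := fun uw ↦
    ⟨(uw.1, (uw.2 : 𝔼 2)), by
      rw [mem_fillingPiece_iff]
      exact lt_of_le_of_lt (mem_closedBall_zero_iff.1 uw.2.2) hρ⟩ with hφ
  have hφc : Continuous φ :=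
    (continuous_fst.prodMk (continuous_subtype_val.comp continuous_snd)).subtype_mk _
  have hrange : {q : fillingPiece | ‖(q : ((𝕊 1) × (𝕊 1)) × (𝔼 2)).2‖ ≤ ρ} = range φ := by
    ext q
    simp only [mem_setOf_eq, mem_range]
    constructor
    · intro hq
      exact ⟨(q.1.1, ⟨q.1.2, mem_closedBall_zero_iff.2 hq⟩), rfl⟩
    · rintro ⟨uw, rfl⟩
      exact mem_closedBall_zero_iff.1 uw.2.2
  rw [hrange]
  exact isCompact_range hφc

include hrel in
/-- **`C_i '' {t ≥ a}` is closed in `X`** for `a > -ε_i`, in the presence of a Dehn filling into a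
Hausdorff `P` by continuous `jA`, `jB`: it is the union of the compact
`C_i '' {a ≤ t ≤ b}` and of `C_i '' {t ≥ b}` (`b > 0`), and the latter has closure inside
`jA⁻¹` of the compact `jB (T² × {‖w‖ ≤ e^{-b}})`, whose points in `range jA` come from heights
`≥ b` (the end of the cusp is properly embedded). [folklore] -/
theorem isClosed_image_Ici [T2Space P] [T2Space X] (hjA : Continuous jA)
    (hjB : ∀ i, Continuous (jB i)) (hdet : ∀ i, (A i).det = 1 ∨ (A i).det = -1)
    (i : Fin k) {a : ℝ} (ha : -(S.cusp i).eps < a) :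
    IsClosed ((S.cusp i) '' {p | a ≤ p.2}) := by
  set C := S.cusp i with hC
  set b : ℝ := max a 0 + 1 with hb
  have hab : a < b := by rw [hb]; linarith [le_max_left a 0]
  have hb0 : 0 < b := by rw [hb]; linarith [le_max_right a 0]
  -- the compact piece
  have hK₁ : IsCompact (C '' {p | a ≤ p.2 ∧ p.2 ≤ b}) := C.isCompact_image_Icc ha
  -- the compact `jB (T² × {‖w‖ ≤ e^{-b}})`
  have hK₂ : IsCompact (jB i '' {q : fillingPiece | ‖(q : ((𝕊 1) × (𝕊 1)) × (𝔼 2)).2‖ ≤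
      Real.exp (-b)}) :=
    (isCompact_fillingPiece_le (by rw [Real.exp_lt_one_iff]; linarith)).image (hjB i)
  have hsub : C '' {p | b ≤ p.2} ⊆ jA ⁻¹' (jB i '' {q : fillingPiece |
      ‖(q : ((𝕊 1) × (𝕊 1)) × (𝔼 2)).2‖ ≤ Real.exp (-b)}) := by
    rintro _ ⟨⟨x, t⟩, (ht : b ≤ t), rfl⟩
    obtain ⟨θ₁, θ₂, θ₃, hx⟩ := exists_cuspPt_eq C (A i) (hdet i) x
    have ht0 : 0 < t := hb0.trans_le ht
    have hr0 : 0 < Real.exp (-t) := Real.exp_pos _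
    have hr1 : Real.exp (-t) < 1 := by rw [Real.exp_lt_one_iff]; linarith
    refine ⟨piecePoint θ₁ θ₂ θ₃ (Real.exp (-t)) hr0.le hr1, ?_, ?_⟩
    · change ‖Real.exp (-t) • ((circlePoint θ₃ : 𝕊 1) : 𝔼 2)‖ ≤ Real.exp (-b)
      rw [norm_smul_circlePoint hr0.le, Real.exp_le_exp]
      linarith
    · rw [← apply_cusp_eq hrel i θ₁ θ₂ θ₃ _ hr0 hr1, Real.log_exp, neg_neg, hx]
  -- decomposition of the set and its closure
  have hdecomp : C '' {p | a ≤ p.2} = C '' {p | a ≤ p.2 ∧ p.2 ≤ b} ∪ C '' {p | b ≤ p.2} := by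
    rw [← image_union]
    congr 1
    ext p
    simp only [mem_setOf_eq, mem_union]
    constructor
    · intro h
      rcases le_total p.2 b with h' | h'
      · exact Or.inl ⟨h, h'⟩
      · exact Or.inr h'
    · rintro (h | h)
      · exact h.1
      · exact hab.le.trans h
  rw [← closure_subset_iff_isClosed, hdecomp, closure_union, union_subset_iff]
  refine ⟨hK₁.isClosed.closure_subset.trans subset_union_left, ?_⟩
  intro x₀ hx₀
  have hcl : IsClosed (jA ⁻¹' (jB i '' {q : fillingPiece |
      ‖(q : ((𝕊 1) × (𝕊 1)) × (𝔼 2)).2‖ ≤ Real.exp (-b)})) :=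
    hK₂.isClosed.preimage hjA
  obtain ⟨q, hq, hqx⟩ := (hcl.closure_subset_iff.2 hsub) hx₀
  -- `q` is not a core point, so it comes from a height `≥ b`
  by_cases hq0 : (q : ((𝕊 1) × (𝕊 1)) × (𝔼 2)).2 = 0
  · exfalso
    obtain ⟨⟨⟨u, v⟩, w⟩, hmem⟩ := q
    change w = 0 at hq0
    subst hq0
    exact core_not_mem_range hrel i u v hmem ⟨x₀, hqx.symm⟩
  · obtain ⟨θ₁, θ₂, θ₃, r, hr0, hr1, hqe, hx₀e⟩ := (hrel i x₀ q).1 hqx.symm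
    have hr : ‖(q : ((𝕊 1) × (𝕊 1)) × (𝔼 2)).2‖ = r := by
      rw [hqe]; exact norm_smul_circlePoint hr0.le θ₃
    have hrb : r ≤ Real.exp (-b) := hr ▸ hq
    have hlog : b ≤ -Real.log r := by
      have := Real.log_le_log hr0 hrb
      rw [Real.log_exp] at this
      linarith
    refine Or.inr ⟨(cuspPt (S.cusp i) (A i) θ₁ θ₂ θ₃, -Real.log r), hlog, ?_⟩
    rw [hx₀e]
    rfl

include hrel in
/-- In particular **the closed cusp neighbourhoods are closed sets**. [folklore] -/
theorem isClosed_closedNbhd [T2Space P] [T2Space X] (hjA : Continuous jA)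
    (hjB : ∀ i, Continuous (jB i)) (hdet : ∀ i, (A i).det = 1 ∨ (A i).det = -1) (i : Fin k) :
    IsClosed (S.cusp i).closedNbhd := by
  have h := isClosed_image_Ici hrel hjA hjB hdet i (a := 0) (by simpa using (S.cusp i).eps_pos)
  rwa [TorusCusp.closedNbhd]

include hrel in
/-- **The enlarged cusps of a Dehn-filled cusped manifold**: a level `t_h < 0`, above `-ε_i` for
all `i`, with the enlarged open cusps `C_i ({t > t_h})` pairwise disjoint
(`TorusCuspSystem.exists_level` and `isClosed_closedNbhd`). [folklore] -/
theorem exists_level_of_dehnFilling [T2Space P] [T2Space X] (hjA : Continuous jA)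
    (hjB : ∀ i, Continuous (jB i)) (hdet : ∀ i, (A i).det = 1 ∨ (A i).det = -1) :
    ∃ th : ℝ, th < 0 ∧ (∀ i, -(S.cusp i).eps < th) ∧
      Pairwise fun i j ↦ Disjoint ((S.cusp i) '' {p | th < p.2}) ((S.cusp j) '' {p | th < p.2}) :=
  S.exists_level (isClosed_closedNbhd hrel hjA hjB hdet)

end DehnFilling

end Literature.Geometry.Riemannian
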